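import Summits.Schanuel.Schanuel.Theorems.RootDecomp1BTameFlagCore

/-!
# RootDecomp1BTameFlagSteps — the TAME FLAG and the WILD DICHOTOMY of lens 4 gen 8 (node `PolarWildFlag`), part 2

* `tameKleinPolar_of_flag_steps : TameSharpStep → TameSurplusOneStep → TameKleinPolar` (re-base a tame direction
  last, `exists_rebase` + `pairDeg_natMul_le`; flag trichotomy `kleinPolar_of_lastTame`), exactness
  `tameKleinPolar_iff_flag_steps`;
* `fedKleinPolar_of_tameKleinPolar`, `fedSharpStep_of_tameSharpStep`, `fedSurplusOneStep_of_tameSurplusOneStep`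
  — the gen-7 pieces FSH / FS1 follow from the gen-8 pieces TSH / TS1;
* `wild_dichotomy : WildSharpHyperplane → LI r → KleinIH m → IsWild m r → (Absorbing m r ∧ 2m − 1 ≤ polarDeg r) ∨ 2m ≤ polarDeg r`.
A route glue uses this file by `import` + definitional unfolding (`exact tameKleinPolar_of_flag_steps hTS hT1 m r hr ih hT`).
Extracted mechanically from HOME/decomp-schanuel-lens-4/g8/PolarWildFlag.lean; sorry-free; standard axioms.
-/

open Complex IntermediateField
open Literature.NumberTheory.Transcendental (trdeg_adjoin_le_of_le isAlgebraic_adjoin_over_algebraAdjoin)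
open Summit.Schanuel.Schanuel.Theorems.RootDecomp1EAnchor (trdeg_adjoin_union_le_sum trdeg_adjoin_le_of_isAlgebraic)

namespace Summit.Schanuel.Schanuel.Theorems.RootDecomp1BTameFlagCore

set_option linter.dupNamespace false

open Summit.Schanuel.Schanuel.Theorems.RootDecomp1BFedFlagCore (FedSharpStep FedSurplusOneStep KleinIH polarDeg baseField IsFed polarGens polarField LastFed FedKleinPolar gens_mono range_polar_init_subset trdeg_adjoin_lt_aleph0 polarDeg_lt_aleph0 coord_mem_span linearIndependent_init two_mul_le_polarDeg_init polarDeg_init_le exists_int_clear coe_mem_adjoin_of_mem_span exists_rebase coe_mem_polarField exp_coe_mem_polarField exp_coe_mul_I_mem_polarField exp_intComb_mem_polarField baseField_le_polarField)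

section

variable {m : ℕ}


/-- Exponentials of span elements are RADICALS over the polar field: `(e^{v})^N, (e^{iv})^N ∈ F(r)` for some `N ≥ 1`. -/
theorem exists_pow_exp_mem_polarField {n : ℕ} (r : Fin n → ℝ) {v : ℝ}
    (hv : v ∈ Submodule.span ℚ (Set.range r)) :
    ∃ N : ℕ, 0 < N ∧ Complex.exp ((v : ℝ) : ℂ) ^ N ∈ polarField r ∧
      Complex.exp (((v : ℝ) : ℂ) * Complex.I) ^ N ∈ polarField r := by
  obtain ⟨c, hc⟩ := (Submodule.mem_span_range_iff_exists_fun ℚ).1 hv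
  obtain ⟨N, nn, hN, hn⟩ := exists_int_clear' c
  have hNv : (N : ℝ) * v = ∑ j, (nn j : ℝ) * r j := by
    rw [← hc, Finset.mul_sum]
    refine Finset.sum_congr rfl fun j _ => ?_
    rw [Rat.smul_def, ← mul_assoc]
    congr 1
    have h' := congrArg (fun q : ℚ => (q : ℝ)) (hn j)
    push_cast at h'
    exact h'
  have hmem := exp_intComb_mem_polarField r nn
  rw [← hNv] at hmem
  have hc : ((((N : ℝ) * v : ℝ)) : ℂ) = (N : ℂ) * ((v : ℝ) : ℂ) := by push_cast; ring
  refine ⟨N, hN, ?_, ?_⟩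
  · rw [← Complex.exp_nat_mul, ← hc]
    exact hmem.1
  · rw [← Complex.exp_nat_mul, ← mul_assoc, ← hc]
    exact hmem.2

set_option synthInstance.maxHeartbeats 200000 in
/-- the polar generators of a sub-span tuple are ALGEBRAIC over the polar field. -/
theorem isAlgebraic_polarGens_of_coords_mem {k n : ℕ} {s : Fin k → ℝ} {r : Fin n → ℝ}
    (hs : ∀ j, s j ∈ Submodule.span ℚ (Set.range r)) :
    ∀ x ∈ polarGens s, IsAlgebraic ↥(polarField r) x := by
  have hB : ∀ j, ((s j : ℝ) : ℂ) ∈ polarField r := fun j =>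
    baseField_le_polarField r (coe_mem_adjoin_of_mem_span r (hs j))
  rintro x (⟨i, rfl⟩ | ⟨i, rfl⟩)
  · induction i using Fin.addCases with
    | left j => simp only [Fin.append_left]; exact isAlgebraic_of_mem' _ (hB j)
    | right j => simp only [Fin.append_right]; exact (isAlgebraic_of_mem' _ (hB j)).mul (isAlgebraic_I _)
  · induction i using Fin.addCases with
    | left j =>
      simp only [Function.comp_apply, Fin.append_left]
      obtain ⟨N, hN, h1, -⟩ := exists_pow_exp_mem_polarField r (hs j)
      exact IsAlgebraic.of_pow hN (isAlgebraic_of_mem' _ h1)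
    | right j =>
      simp only [Function.comp_apply, Fin.append_right]
      obtain ⟨N, hN, -, h2⟩ := exists_pow_exp_mem_polarField r (hs j)
      exact IsAlgebraic.of_pow hN (isAlgebraic_of_mem' _ h2)

/-- POLAR DEGREES ARE MONOTONE ALONG SUB-SPANS: `span_ℚ(s) ≤ span_ℚ(r) ⟹ t(s) ≤ t(r)`. -/
theorem polarDeg_le_of_coords_mem {k n : ℕ} {s : Fin k → ℝ} {r : Fin n → ℝ}
    (hs : ∀ j, s j ∈ Submodule.span ℚ (Set.range r)) : polarDeg s ≤ polarDeg r :=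
  trdeg_adjoin_le_of_isAlgebraic (isAlgebraic_polarGens_of_coords_mem hs)

/-- Unfolding of `Absorbing (m+1)`. -/
theorem absorbing_succ_iff (r : Fin (m + 1) → ℝ) :
    Absorbing (m + 1) r ↔ ∀ (w : Fin m → ℝ), LinearIndependent ℚ w →
      (∀ j, w j ∈ Submodule.span ℚ (Set.range r)) → ((m + m + 1 : ℕ) : Cardinal) ≤ polarDeg w := by
  constructor
  · intro h w hw hws
    exact h m rfl w hw hws
  · intro h k hk w hw hws
    obtain rfl : k = m := Nat.add_right_cancel hk
    exact h w hw hws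

/-- Either the tuple is absorbing or it has a sharp hyperplane. -/
theorem absorbing_or_hasSharpHyperplane (r : Fin (m + 1) → ℝ) :
    Absorbing (m + 1) r ∨ HasSharpHyperplane m r := by
  by_cases h : HasSharpHyperplane m r
  · exact Or.inr h
  · left
    rw [absorbing_succ_iff]
    intro w hw hws
    by_contra hlt
    apply h
    refine ⟨w, hw, hws, ?_⟩
    obtain ⟨n, hn⟩ := Cardinal.lt_aleph0.mp (polarDeg_lt_aleph0 w)
    rw [hn] at hlt ⊢
    norm_cast at hlt ⊢
    omega

/-- An ABSORBING tuple has `t ≥ 2m − 1` FOR FREE: its initial hyperplane already has `t(r') ≥ 2(m − 1) + 1`. -/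
theorem pred_le_polarDeg_of_absorbing {r : Fin (m + 1) → ℝ} (hr : LinearIndependent ℚ r)
    (h : Absorbing (m + 1) r) : ((m + 1 + (m + 1) - 1 : ℕ) : Cardinal) ≤ polarDeg r := by
  have h' := (absorbing_succ_iff r).mp h (Fin.init r) (linearIndependent_init hr) (init_mem_span r)
  have e : (m + 1 + (m + 1) - 1 : ℕ) = m + m + 1 := by omega
  rw [e]
  exact h'.trans (polarDeg_init_le r)

/-- THE WILD DICHOTOMY under `KleinIH`: either some hyperplane of the span is SHARP — then the piece
`WildSharpHyperplane` proves X at `r` outright — or the tuple is ABSORBING and `t ≥ 2m − 1` comes for free. -/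
theorem wild_dichotomy (hW : WildSharpHyperplane) {r : Fin m → ℝ} (hr : LinearIndependent ℚ r) (hIH : KleinIH m)
    (hWld : IsWild m r) :
    (Absorbing m r ∧ ((m + m - 1 : ℕ) : Cardinal) ≤ polarDeg r) ∨ ((m + m : ℕ) : Cardinal) ≤ polarDeg r := by
  cases m with
  | zero => exact Or.inr (by simp)
  | succ k =>
    rcases absorbing_or_hasSharpHyperplane r with hA | hS
    · exact Or.inl ⟨hA, pred_le_polarDeg_of_absorbing hr hA⟩
    · exact Or.inr (hW k r hr hIH hWld hS)

/-- FLAG TRICHOTOMY at a TAME last coordinate: `s' = 0 | 1 | ≥ 2` (copy of `kleinPolar_of_lastFed`). -/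
theorem kleinPolar_of_lastTame (hS : TameSharpStep) (h1 : TameSurplusOneStep) {r : Fin (m + 1) → ℝ}
    (hr : LinearIndependent ℚ r) (hIH : KleinIH (m + 1)) (ht : LastTame m r) :
    ((m + 1 + (m + 1) : ℕ) : Cardinal) ≤ polarDeg r := by
  have hlow := two_mul_le_polarDeg_init hr hIH
  have hmono := polarDeg_init_le r
  obtain ⟨n', hn'⟩ := Cardinal.lt_aleph0.mp (polarDeg_lt_aleph0 (Fin.init r))
  rw [hn'] at hlow hmono
  have hlow' : m + m ≤ n' := by exact_mod_cast hlow
  rcases Nat.lt_or_ge n' (m + m + 2) with hlt | hge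
  · rcases Nat.lt_or_ge n' (m + m + 1) with hlt1 | hge1
    · have h4 : polarDeg (Fin.init r) ≤ ((m + m : ℕ) : Cardinal) := by
        rw [hn']
        exact_mod_cast (by omega : n' ≤ m + m)
      exact hS m r hr hIH ht h4
    · have h4 : polarDeg (Fin.init r) = ((m + m + 1 : ℕ) : Cardinal) := by
        rw [hn']
        exact_mod_cast (by omega : n' = m + m + 1)
      exact h1 m r hr hIH ht h4
  · calc ((m + 1 + (m + 1) : ℕ) : Cardinal) ≤ (n' : Cardinal) := by
          exact_mod_cast (by omega : m + 1 + (m + 1) ≤ n')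
      _ ≤ polarDeg r := hmono

set_option synthInstance.maxHeartbeats 200000 in
/-- transport of the type along re-basing: `pairDeg w (N v) ≤ pairDeg r v` whenever `span_ℚ(w) ≤ span_ℚ(r)`
(`ℚ(w) ≤ ℚ(r)` and `e^{Nv} = (e^{v})^N`). -/
theorem pairDeg_natMul_le {k n : ℕ} {w : Fin k → ℝ} {r : Fin n → ℝ}
    (hw : ∀ j, w j ∈ Submodule.span ℚ (Set.range r)) (N : ℕ) (v : ℝ) :
    pairDeg w ((N : ℝ) * v) ≤ pairDeg r v := by
  refine trdeg_le_of_injective (IntermediateField.inclusion (?_ : _ ≤ _)) (IntermediateField.inclusion_injective _)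
  rw [adjoin_le_iff]
  have hsub : Set.range (fun j => ((r j : ℝ) : ℂ)) ∪
      {Complex.exp ((v : ℝ) : ℂ), Complex.exp (((v : ℝ) : ℂ) * Complex.I)} ⊆
      (IntermediateField.adjoin ℚ (Set.range (fun j => ((r j : ℝ) : ℂ)) ∪
        {Complex.exp ((v : ℝ) : ℂ), Complex.exp (((v : ℝ) : ℂ) * Complex.I)}) : Set ℂ) := subset_adjoin ℚ _
  have hc : ((((N : ℝ) * v : ℝ)) : ℂ) = (N : ℂ) * ((v : ℝ) : ℂ) := by push_cast; ring
  rintro x (⟨j, rfl⟩ | hx)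
  · exact adjoin.mono ℚ _ _ Set.subset_union_left (coe_mem_adjoin_of_mem_span r (hw j))
  · simp only [Set.mem_insert_iff, Set.mem_singleton_iff] at hx
    rcases hx with rfl | rfl
    · rw [hc, Complex.exp_nat_mul]
      exact pow_mem (hsub (Or.inr (Or.inl rfl))) N
    · rw [hc, mul_assoc, Complex.exp_nat_mul]
      exact pow_mem (hsub (Or.inr (Or.inr rfl))) N

/-- THE TAME LENGTH REDUCTION: TSH ∧ TS1 ⟹ X at every TAME tuple, under `KleinIH`.  Proof: re-base so that the tame
direction is (an integer multiple of itself as) the last coordinate (`exists_rebase`; `t(w) ≤ t(r)` by sub-span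
monotonicity, `ρ(w) = ρ(r)`, the type can only drop), then the tame trichotomy. -/
theorem tameKleinPolar_of_flag_steps (hS : TameSharpStep) (h1 : TameSurplusOneStep) : TameKleinPolar := by
  intro m₀ r hr hIH ht
  obtain ⟨v, hv, hv0, hle⟩ := ht
  obtain ⟨m, rfl⟩ : ∃ m, m₀ = m + 1 := by
    rcases Nat.eq_zero_or_pos m₀ with h0 | hpos
    · subst h0
      rw [Set.range_eq_empty, Submodule.span_empty, Submodule.mem_bot] at hv
      exact absurd hv hv0
    · exact ⟨m₀ - 1, (Nat.succ_pred_eq_of_pos hpos).symm⟩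
  obtain ⟨w, N, n, hN, hw, hw_last, hNv, hw_init, hw_span, hr_span⟩ := exists_rebase hr hv hv0
  have ht : polarDeg w ≤ polarDeg r := polarDeg_le_of_coords_mem hw_span
  have hρ : baseDeg w = baseDeg r := baseDeg_eq_of_span_eq hw_span hr_span
  have htame : LastTame m w := by
    unfold LastTame
    rw [hw_last, hρ]
    exact (pairDeg_natMul_le hw_span N v).trans hle
  exact (kleinPolar_of_lastTame hS h1 hw hIH htame).trans ht

/-- The tame Klein–polar statement gives back the tame sharp step. -/
theorem tameSharpStep_of_tameKleinPolar (h : TameKleinPolar) : TameSharpStep :=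
  fun m r hr hIH ht _ => h (m + 1) r hr hIH (isTame_of_lastTame hr ht)

/-- The tame Klein–polar statement gives back the tame surplus-one step. -/
theorem tameSurplusOneStep_of_tameKleinPolar (h : TameKleinPolar) : TameSurplusOneStep :=
  fun m r hr hIH ht _ => h (m + 1) r hr hIH (isTame_of_lastTame hr ht)

/-- EXACTNESS of the tame flag: `TameKleinPolar ⟺ TameSharpStep ∧ TameSurplusOneStep`. -/
theorem tameKleinPolar_iff_flag_steps : TameKleinPolar ↔ (TameSharpStep ∧ TameSurplusOneStep) :=
  ⟨fun h => ⟨tameSharpStep_of_tameKleinPolar h, tameSurplusOneStep_of_tameKleinPolar h⟩,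
    fun h => tameKleinPolar_of_flag_steps h.1 h.2⟩

/-- Fed ⟹ tame: the gen-7 fed Klein–polar statement follows from the tame one. -/
theorem fedKleinPolar_of_tameKleinPolar (h : TameKleinPolar) : FedKleinPolar :=
  fun m r hr hIH hfed => h m r hr hIH (isTame_of_isFed hfed)

/-- LEDGER GLUE (retires FSH = stmt-Schanuel-31200): `TameSharpStep → FedSharpStep`, pointwise (fed ⟹ tame). -/
theorem fedSharpStep_of_tameSharpStep (h : TameSharpStep) : FedSharpStep :=
  fun m r hr hIH hfed hle => h m r hr hIH (lastTame_of_lastFed hfed) hle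

/-- LEDGER GLUE (retires FS1 = stmt-Schanuel-31201): `TameSurplusOneStep → FedSurplusOneStep`, pointwise. -/
theorem fedSurplusOneStep_of_tameSurplusOneStep (h : TameSurplusOneStep) : FedSurplusOneStep :=
  fun m r hr hIH hfed heq => h m r hr hIH (lastTame_of_lastFed hfed) heq

end

end Summit.Schanuel.Schanuel.Theorems.RootDecomp1BTameFlagCore
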